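import Mathlib
import HarnessLib
import Literature.Analysis.FluidPDE.WholeSpaceIBP
import Literature.Analysis.FluidPDE.TaoEnstrophyLocalisationProofs
import Literature.Analysis.FluidPDE.TypeIAncientMildClassical
import Summits.NavierStokesRegularity.NavierStokesRegularity.Theorems.PoloidalWindowDoorPoloidalWindowRigidityWindow
import Summits.NavierStokesRegularity.NavierStokesRegularity.Theorems.PoloidalWindowDoorPoloidalWindowRigidityClassSpaceTimeRates

/-!
# K2 `PoloidalWindowRigidity` (stmt-NavierStokesRegularity-19708) — LARGE-SCALE EQUIPARTITION:
# the bilinear null-Lagrangian `⟪a, (Dv)² b⟫ = div(⟪v,a⟫ ∂_b v)` and its poloidal reading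

Cell ns-regularity-ideate, seat nsreg-p7 gen 7 (third worker under the K2 lead ns-poloidal-K2-p1; the lead's wish-list
K2P1-M11-NOTES §1(d)/§4(c) «`…Equipartition`: one divergence theorem»).

* `divergence_inner_smul_fderiv_apply` — for a `C²` divergence-free field `v` on a finite-dimensional inner product
  space and fixed vectors `a, b`: `div (⟪v, a⟫ • ∂_b v) = ⟪Dv (Dv b), a⟫` pointwise (every entry of `(Dv)²` is a
  divergence: `∂_b` commutes with `div`, so `div ∂_b v = 0`).
* `integral_mul_inner_fderiv_fderiv_eq` — against a `C¹_c` weight `φ`: `∫ φ ⟪Dv(Dv b), a⟫ = −∫ ⟪v,a⟫ Dφ(Dv b)`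
  (divergence theorem without boundary, tree `integral_mul_divergence_add_eq_zero_left`).
* `abs_integral_cutoff_mul_inner_fderiv_fderiv_le` — on `ℝ³` with the tree's cut-off `cutoff R` (`= 1` on `B̄_R`,
  supported in `B̄_{2R}`, `‖D cutoff R‖ ≤ C₁/R`): for `‖v‖ ≤ M`, `‖Dv‖ ≤ M₁`,
  `|∫ cutoff R · ⟪Dv(Dv b), a⟫| ≤ |B̄(0,2R)| · ‖a‖‖b‖ M M₁ C₁/R` — the LARGE-SCALE MEAN OF EVERY ENTRY OF `(Dv)²`
  IS `O(‖v‖∞‖Dv‖∞/R)` for every bounded `C²` divergence-free field (whole KNSS class, no equation used).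
* `inner_sq_vertical_of_shear` — pointwise algebra of the poloidal frozen class: if `∂₂v_b = m ∂_b v₂` (`b = 0,1`;
  `m` the shear ratio `= 1 − 1/Λ`, `Λ` the Clebsch slope) then `⟪Dv(Dv e₂), e₂⟫ = m |∇_h v₂|² + (∂₂v₂)²`.
* `abs_integral_cutoff_shearEnergy_le_of_class` — for a profile of the route's Type-I class and a slice `s < 0` on
  which `∂₂v_h = m ∇_h v₂` pointwise: `|∫ cutoff R · (m|∇_hv₂|² + (∂₂v₂)²)| ≤ |B̄(0,2R)| · K/(R (−s)√(−s))` with ONE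
  `K` per profile — the elliptic (`m > 0`) and hyperbolic (`m < 0`) parts of every slice BALANCE at large scales
  (K2P1-M11-NOTES §1(d): `e_M = ⟪∂₂v, ∇v₂⟫ = ¼(|2Se₂|² − |ω|²)`), at the rate `C·K₁·(−s)^{−3/2}/R`.

WHAT THIS IS NOT: not a claim about Navier–Stokes regularity and not the crux — kinematic large-scale identities for
the portrait of the residue S2⁗ (bears_on LADDER-NS N0, route PoloidalWindowDoor, crux K2; `--supports` the K2 item).
-/

noncomputable section

-- the summit and its single sub-problem share the name (CONVENTIONS §1), as in every Theorems file
set_option linter.dupNamespace false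

namespace Summit.NavierStokesRegularity.NavierStokesRegularity.Theorems.PoloidalWindowDoorPoloidalWindowRigidityEquipartition

open MeasureTheory Set Function Filter Topology Metric InnerProductSpace
open scoped RealInnerProductSpace ENNReal
open Literature.Analysis Literature.Analysis.FluidPDE
open Summit.NavierStokesRegularity.NavierStokesRegularity.Theorems.PoloidalWindowDoorPoloidalWindowRigidityWindow
open Summit.NavierStokesRegularity.NavierStokesRegularity.Theorems.PoloidalWindowDoorPoloidalWindowRigidityClassSpaceTimeRates

/-! ### the bilinear null-Lagrangian on a finite-dimensional inner product space -/

section General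

variable {E : Type*} [NormedAddCommGroup E] [InnerProductSpace ℝ E] [FiniteDimensional ℝ E]

/-- **Every entry of `(Dv)²` is a divergence.**  For a `C²` divergence-free field `v` and fixed vectors `a, b`:
`div (⟪v, a⟫ • ∂_b v)(x) = ⟪Dv(x)(Dv(x) b), a⟫` (Leibniz rule; `div ∂_b v = ∂_b div v = 0`). -/
theorem divergence_inner_smul_fderiv_apply {v : E → E} (hv : ContDiff ℝ 2 v)
    (hdiv : VectorCalculus.IsDivFree v) (a b x : E) :
    VectorCalculus.divergence (fun y => ⟪v y, a⟫ • fderiv ℝ v y b) x = ⟪fderiv ℝ v x (fderiv ℝ v x b), a⟫ := by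
  have hv1 : Differentiable ℝ v := hv.differentiable (by simp)
  have hθ : DifferentiableAt ℝ (fun y => ⟪v y, a⟫) x := (hv1 x).inner ℝ (differentiableAt_const a)
  have hW : DifferentiableAt ℝ (fun y => fderiv ℝ v y b) x :=
    (((hv.fderiv_right (m := 1) le_rfl).differentiable one_ne_zero) x).clm_apply (differentiableAt_const b)
  rw [divergence_smul_apply hθ hW, (VectorCalculus.IsDivFree.fderiv_apply hv hdiv b) x, mul_zero, zero_add,
    real_inner_comm, gradient, InnerProductSpace.toDual_symm_apply,
    fderiv_inner_apply ℝ (hv1 x) (differentiableAt_const a)]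
  simp

variable [MeasurableSpace E] [BorelSpace E]

/-- **The integrated null-Lagrangian.**  For a `C²` divergence-free field `v`, a compactly supported `C¹` weight
`φ` and fixed vectors `a, b`: `∫ φ ⟪Dv(Dv b), a⟫ = −∫ ⟪v, a⟫ Dφ(Dv b)` (divergence theorem without boundary). -/
theorem integral_mul_inner_fderiv_fderiv_eq {v : E → E} (hv : ContDiff ℝ 2 v)
    (hdiv : VectorCalculus.IsDivFree v) {φ : E → ℝ} (hφ : ContDiff ℝ 1 φ) (hφc : HasCompactSupport φ)
    (a b : E) :
    ∫ x, φ x * ⟪fderiv ℝ v x (fderiv ℝ v x b), a⟫ = -∫ x, ⟪v x, a⟫ * fderiv ℝ φ x (fderiv ℝ v x b) := by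
  have hv1 : ContDiff ℝ 1 v := hv.of_le (by norm_num)
  have hF : ContDiff ℝ 1 (fun y => ⟪v y, a⟫ • fderiv ℝ v y b) :=
    (hv1.inner ℝ contDiff_const).smul ((hv.fderiv_right (m := 1) le_rfl).clm_apply contDiff_const)
  have h := integral_mul_divergence_add_eq_zero_left hφ hF hφc
  have h1 : (fun x => φ x * VectorCalculus.divergence (fun y => ⟪v y, a⟫ • fderiv ℝ v y b) x) =
      fun x => φ x * ⟪fderiv ℝ v x (fderiv ℝ v x b), a⟫ := by
    funext x; rw [divergence_inner_smul_fderiv_apply hv hdiv a b x]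
  have h2 : (fun x => ⟪⟪v x, a⟫ • fderiv ℝ v x b, gradient φ x⟫) =
      fun x => ⟪v x, a⟫ * fderiv ℝ φ x (fderiv ℝ v x b) := by
    funext x
    rw [real_inner_smul_left, gradient,
      real_inner_comm ((InnerProductSpace.toDual ℝ E).symm (fderiv ℝ φ x)), InnerProductSpace.toDual_symm_apply]
  rw [h1, h2] at h
  linarith

end General

/-! ### three dimensions: the large-scale bound with the tree's cut-off -/

/-- **LARGE-SCALE EQUIPARTITION (whole class, kinematic).**  For a bounded `C²` divergence-free field `v` on `ℝ³` with
`‖v‖ ≤ M`, `‖Dv‖ ≤ M₁`, the cut-off `cutoff R` (`R > 0`, gradient bound `C₁/R`) and fixed vectors `a, b`: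
`|∫ cutoff R · ⟪Dv(Dv b), a⟫| ≤ |B̄(0,2R)| · (‖a‖ ‖b‖ M M₁ C₁/R)` — the mean of every entry of `(Dv)²` over a ball of
radius `R` is `O(M M₁/R)`. -/
theorem abs_integral_cutoff_mul_inner_fderiv_fderiv_le
    {v : EuclideanSpace ℝ (Fin 3) → EuclideanSpace ℝ (Fin 3)} (hv : ContDiff ℝ 2 v)
    (hdiv : VectorCalculus.IsDivFree v) {M M₁ R C₁ : ℝ} (hR : 0 < R) (hM : ∀ x, ‖v x‖ ≤ M)
    (hM₁ : ∀ x, ‖fderiv ℝ v x‖ ≤ M₁)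
    (hC₁ : ∀ x, ‖fderiv ℝ (cutoff (E := EuclideanSpace ℝ (Fin 3)) R) x‖ ≤ C₁ / R)
    (a b : EuclideanSpace ℝ (Fin 3)) :
    |∫ x, cutoff (E := EuclideanSpace ℝ (Fin 3)) R x * ⟪fderiv ℝ v x (fderiv ℝ v x b), a⟫| ≤
      volume.real (closedBall (0 : EuclideanSpace ℝ (Fin 3)) (2 * R)) * (‖a‖ * ‖b‖ * M * M₁ * (C₁ / R)) := by
  rw [integral_mul_inner_fderiv_fderiv_eq hv hdiv (contDiff_cutoff (n := 1) R) (hasCompactSupport_cutoff hR) a b,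
    abs_neg]
  set K : Set (EuclideanSpace ℝ (Fin 3)) := closedBall (0 : EuclideanSpace ℝ (Fin 3)) (2 * R) with hKdef
  have hD0 : ∀ x ∉ K, fderiv ℝ (cutoff (E := EuclideanSpace ℝ (Fin 3)) R) x = 0 := fun x hx =>
    fderiv_of_notMem_tsupport ℝ fun h' => hx (FluidPDE.tsupport_cutoff_subset hR h')
  have hsupp : ∀ x ∉ K, ⟪v x, a⟫ * fderiv ℝ (cutoff (E := EuclideanSpace ℝ (Fin 3)) R) x (fderiv ℝ v x b) = 0 :=
    fun x hx => by rw [hD0 x hx]; simp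
  rw [← setIntegral_eq_integral_of_forall_compl_eq_zero hsupp]
  have hM0 : 0 ≤ M := (norm_nonneg _).trans (hM 0)
  have hM₁0 : 0 ≤ M₁ := (norm_nonneg _).trans (hM₁ 0)
  have hC₁0 : 0 ≤ C₁ / R := (norm_nonneg _).trans (hC₁ 0)
  have hpt : ∀ x ∈ K, ‖⟪v x, a⟫ * fderiv ℝ (cutoff (E := EuclideanSpace ℝ (Fin 3)) R) x (fderiv ℝ v x b)‖ ≤
      ‖a‖ * ‖b‖ * M * M₁ * (C₁ / R) := by
    intro x _
    rw [norm_mul]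
    have h1 : ‖⟪v x, a⟫‖ ≤ M * ‖a‖ := by
      rw [Real.norm_eq_abs]
      exact (abs_real_inner_le_norm _ _).trans (mul_le_mul_of_nonneg_right (hM x) (norm_nonneg _))
    have h2 : ‖fderiv ℝ (cutoff (E := EuclideanSpace ℝ (Fin 3)) R) x (fderiv ℝ v x b)‖ ≤ C₁ / R * (M₁ * ‖b‖) := by
      refine (ContinuousLinearMap.le_opNorm _ _).trans ?_
      refine mul_le_mul (hC₁ x) ?_ (norm_nonneg _) hC₁0
      exact (ContinuousLinearMap.le_opNorm _ _).trans (mul_le_mul_of_nonneg_right (hM₁ x) (norm_nonneg _))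
    calc ‖⟪v x, a⟫‖ * ‖fderiv ℝ (cutoff (E := EuclideanSpace ℝ (Fin 3)) R) x (fderiv ℝ v x b)‖
        ≤ (M * ‖a‖) * (C₁ / R * (M₁ * ‖b‖)) :=
          mul_le_mul h1 h2 (norm_nonneg _) (mul_nonneg hM0 (norm_nonneg _))
      _ = ‖a‖ * ‖b‖ * M * M₁ * (C₁ / R) := by ring
  have hKfin : volume K < ⊤ := measure_closedBall_lt_top
  have h := norm_setIntegral_le_of_norm_le_const hKfin hpt
  rw [Real.norm_eq_abs] at h
  linarith

/-! ### the poloidal reading -/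

/-- Coordinates of a linear image in the standard frame of `ℝ³`: `(L w)ᵢ = Σⱼ wⱼ (L eⱼ)ᵢ`. -/
theorem clm_apply_coord_eq_sum (L : EuclideanSpace ℝ (Fin 3) →L[ℝ] EuclideanSpace ℝ (Fin 3))
    (w : EuclideanSpace ℝ (Fin 3)) (i : Fin 3) :
    L w i = ∑ j, w j * L (EuclideanSpace.single j (1 : ℝ)) i := by
  have hw : w = ∑ j, w j • (EuclideanSpace.single j (1 : ℝ) : EuclideanSpace ℝ (Fin 3)) := by
    conv_lhs => rw [← (EuclideanSpace.basisFun (Fin 3) ℝ).sum_repr' w]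
    simp [EuclideanSpace.basisFun_apply, EuclideanSpace.inner_single_left]
  conv_lhs => rw [hw]
  simp [map_sum, map_smul, Finset.sum_apply, smul_eq_mul]

/-- **The vertical–vertical entry of `(Dv)²` on the poloidal frozen class.**  If the vertical shear is proportional
to the horizontal gradient of the vertical velocity, `(L e₂)_b = m (L e_b)₂` for `b = 0, 1` (`L = Dv(x)`,
`∂₂v_b = m ∂_b v₂`), then `⟪L(L e₂), e₂⟫ = m((L e₀)₂² + (L e₁)₂²) + (L e₂)₂²`, i.e.
`⟪Dv(∂₂v), e₂⟫ = m|∇_h v₂|² + (∂₂v₂)²`. -/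
theorem inner_sq_vertical_of_shear (L : EuclideanSpace ℝ (Fin 3) →L[ℝ] EuclideanSpace ℝ (Fin 3)) {m : ℝ}
    (h0 : L (EuclideanSpace.single 2 (1 : ℝ)) 0 = m * L (EuclideanSpace.single 0 (1 : ℝ)) 2)
    (h1 : L (EuclideanSpace.single 2 (1 : ℝ)) 1 = m * L (EuclideanSpace.single 1 (1 : ℝ)) 2) :
    ⟪L (L (EuclideanSpace.single 2 (1 : ℝ))), EuclideanSpace.single 2 (1 : ℝ)⟫ =
      m * (L (EuclideanSpace.single 0 (1 : ℝ)) 2 ^ 2 + L (EuclideanSpace.single 1 (1 : ℝ)) 2 ^ 2) +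
        L (EuclideanSpace.single 2 (1 : ℝ)) 2 ^ 2 := by
  rw [EuclideanSpace.inner_single_right, one_mul, conj_trivial, clm_apply_coord_eq_sum, Fin.sum_univ_three, h0, h1]
  ring

variable {C : ℝ} {v : ℝ → EuclideanSpace ℝ (Fin 3) → EuclideanSpace ℝ (Fin 3)}

/-- **LARGE-SCALE EQUIPARTITION ON THE POLOIDAL FROZEN CLASS.**  For a profile of the route's Type-I class there is
ONE constant `K ≥ 0` such that on every slice `s < 0` on which the vertical shear is proportional to the horizontal
gradient of the vertical velocity, `∂₂v_b(y) = m(y) ∂_b v₂(y)` (`b = 0,1`; `m` arbitrary, e.g. the shear ratio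
`1 − 1/Λ` of the Clebsch slope off the critical set), and for every `R > 0`:
`|∫ cutoff R · (m |∇_h v₂|² + (∂₂v₂)²)| ≤ |B̄(0,2R)| · K/(R · (−s)√(−s))` — the elliptic (`m > 0`) and the hyperbolic
(`m < 0`) parts of the slice balance at large scales. -/
theorem abs_integral_cutoff_shearEnergy_le_of_class (hrate : HasTypeITimeDecay C v)
    (hcont : ContinuousOn (uncurry v) (Iio (0 : ℝ) ×ˢ univ))
    (hmild : ∀ s t : ℝ, s < t → t < 0 → ∀ y,
      v t y = UnboundedOperators.heatExtension (v s) (t - s) y - oseenDuhamel 1 s v v t y)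
    (hdiv : ∀ t < 0, VectorCalculus.IsDivFree (v t)) :
    ∃ K : ℝ, 0 ≤ K ∧ ∀ s < 0, ∀ (m : EuclideanSpace ℝ (Fin 3) → ℝ),
      (∀ y, fderiv ℝ (v s) y (EuclideanSpace.single 2 1) 0 = m y * fderiv ℝ (v s) y (EuclideanSpace.single 0 1) 2 ∧
        fderiv ℝ (v s) y (EuclideanSpace.single 2 1) 1 = m y * fderiv ℝ (v s) y (EuclideanSpace.single 1 1) 2) →
      ∀ R : ℝ, 0 < R →
        |∫ y, cutoff (E := EuclideanSpace ℝ (Fin 3)) R y *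
            (m y * (fderiv ℝ (v s) y (EuclideanSpace.single 0 1) 2 ^ 2 + fderiv ℝ (v s) y (EuclideanSpace.single 1 1) 2 ^ 2) +
              fderiv ℝ (v s) y (EuclideanSpace.single 2 1) 2 ^ 2)| ≤
          volume.real (closedBall (0 : EuclideanSpace ℝ (Fin 3)) (2 * R)) * (K / (R * ((-s) * Real.sqrt (-s)))) := by
  obtain ⟨K₁, hK₁0, hK₁⟩ := exists_fderiv_rate_of_class' hrate hcont hmild
  obtain ⟨C₁, hC₁0, hC₁⟩ := exists_norm_fderiv_cutoff_le (E := EuclideanSpace ℝ (Fin 3))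
  have hC0 : 0 ≤ max C 0 := le_max_right _ _
  refine ⟨max C 0 * K₁ * C₁, by positivity, fun s hs m hm R hR => ?_⟩
  have hns : 0 < -s := neg_pos.2 hs
  have hsq : 0 < Real.sqrt (-s) := Real.sqrt_pos.2 hns
  -- the slice is smooth (the class is classical on `(2s, 0) ∋ s`)
  have h2s : 2 * s < 0 := by linarith
  have hv2 : ContDiff ℝ 2 (v s) := by
    obtain ⟨p, hcl⟩ :=
      (isTypeIAncientMild_of_class hrate hcont hmild hdiv).exists_isClassicalNSSolutionOn_Ioo h2s
    exact (hcl.contDiff_velocity ⟨by linarith, hs⟩).of_le (by norm_cast)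
  -- the entry `⟪Dv(Dv e₂), e₂⟫` is the shear energy, pointwise
  have hpt : ∀ y, ⟪fderiv ℝ (v s) y (fderiv ℝ (v s) y (EuclideanSpace.single 2 1)), EuclideanSpace.single 2 1⟫ =
      m y * (fderiv ℝ (v s) y (EuclideanSpace.single 0 1) 2 ^ 2 + fderiv ℝ (v s) y (EuclideanSpace.single 1 1) 2 ^ 2) +
        fderiv ℝ (v s) y (EuclideanSpace.single 2 1) 2 ^ 2 := fun y =>
    inner_sq_vertical_of_shear (fderiv ℝ (v s) y) (hm y).1 (hm y).2
  have hint : ∫ y, cutoff (E := EuclideanSpace ℝ (Fin 3)) R y *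
      (m y * (fderiv ℝ (v s) y (EuclideanSpace.single 0 1) 2 ^ 2 + fderiv ℝ (v s) y (EuclideanSpace.single 1 1) 2 ^ 2) +
        fderiv ℝ (v s) y (EuclideanSpace.single 2 1) 2 ^ 2) =
      ∫ y, cutoff (E := EuclideanSpace ℝ (Fin 3)) R y *
        ⟪fderiv ℝ (v s) y (fderiv ℝ (v s) y (EuclideanSpace.single 2 1)), EuclideanSpace.single 2 1⟫ := by
    refine integral_congr_ae (Eventually.of_forall fun y => ?_)
    simp only [hpt y]
  rw [hint]
  -- the whole-class bound with `M = max C 0/√(−s)`, `M₁ = K₁/(−s)`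
  have hM : ∀ y, ‖v s y‖ ≤ max C 0 / Real.sqrt (-s) := fun y =>
    (hrate s hs y).trans (div_le_div_of_nonneg_right (le_max_left _ _) hsq.le)
  have h := abs_integral_cutoff_mul_inner_fderiv_fderiv_le hv2 (hdiv s hs) hR hM (hK₁ s hs) (hC₁ R hR)
    (EuclideanSpace.single 2 1) (EuclideanSpace.single 2 1)
  refine h.trans (le_of_eq ?_)
  have he : ‖(EuclideanSpace.single 2 (1 : ℝ) : EuclideanSpace ℝ (Fin 3))‖ = 1 := by
    simp
  rw [he]
  congr 1
  field_simp

end Summit.NavierStokesRegularity.NavierStokesRegularity.Theorems.PoloidalWindowDoorPoloidalWindowRigidityEquipartition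

end
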